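import Literature.NumberTheory.EllipticCurves.Kato2004.MemberRealisationPrint
import Summits.BirchSwinnertonDyer.Rank1Residual.Additive.RamifiedSevenMuFreeDiagonalGauge
import Summits.BirchSwinnertonDyer.Rank1Residual.X12.CMSevenAwayFromSeven
import Summits.BirchSwinnertonDyer.Rank1Residual.Additive.RamifiedSevenPrimitiveAdmissibleMemberUpToUnit
import Literature.NumberTheory.EllipticCurves.Kato2004.IwasawaCohomologyEulerSystemLiftComp
import Literature.NumberTheory.EllipticCurves.Kato2004.IntegralH1CorestrictionMackey
import Literature.NumberTheory.EllipticCurves.Kato2004.ValueGuardSatisfiableProofs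
import Literature.NumberTheory.EllipticCurves.PAdicLFunctionMinusDenominatorsProofs
import Literature.NumberTheory.EllipticCurves.ModularSymbolsManinDrinfeldGeneralProofs
import Literature.NumberTheory.EllipticCurves.PAdicLFunctionProofs
import Literature.NumberTheory.EllipticCurves.NewformPeriodRatio
import Literature.NumberTheory.GaloisRepresentations.CyclotomicCharacterSurjectiveProofs
import Literature.NumberTheory.EllipticCurves.HeegnerEnvelopeReverseCoherentProofs
import Mathlib.GroupTheory.Archimedean
import HarnessLib

/-!
# THE (E2) GLUE: `F•₇′` (print, `Kato2004.kato2004_classCSeven_memberRealisationPrint`) + `hR3c` (typed) ⟹ the statement of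
# `stub_muFreeRealisedFamilySeven` VERBATIM — port of ideator g68's kernel assembly to a BUILT home

Crux `stmt-BirchSwinnertonDyer-19945` (K7r; line `Cruxes/EllipticUnitValueSevenOfGZK/Lines/kato_perrin_riou_zp.lean` v14 6f202717661c60d4,
stub (E2) l.604–610), cell `bsd-cm` vote V-E2 (D962) and pen rulings D973 (b)(c)(d) / D974; seat `bsd-cm-prr-ty1` g32.

WHAT THIS FILE DOES (kernel, theorems only; nothing is asserted):
* §1–§3 = g68 `RealisationAssemblySeven_g68.lean` (d2c3fb8381c0379f) §1–§3 VERBATIM under the namespace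
  `Summit.BirchSwinnertonDyer.Rank1Residual.Additive.MemberRealisation`: the Manin minus lattice is cyclic with a positive
  generator (`exists_pos_closure_range_ratMinusSymbol`); Galois elements with prescribed cyclotomic character
  (`exists_cyclotomicCharacter_eq_intCast/_natCast/_primeFactors`; g68's `isUnit_intCast_padicInt` is the tree's
  `isUnit_intCast_padicInt_of_not_dvd`, reused); the `hint` input of the Λ-adic lift discharged
  (`levelToLayer_mem_integralH1`, `existsUnique_lift_of_zetaBody`).
* §4 = g68 §5 VERBATIM with the letters now read from `Literature/…/Kato2004/MemberRealisationPrint.lean` and the gauge lemmas from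
  the ports `RamifiedSevenMuFreeMultiplier` / `RamifiedSevenMuFreeDiagonalGauge`: `hasMuFreeRealisedZetaFamilyBody_of_memberRealisationBody`,
  `hasMuFreeRealisedZetaFamily_of_memberRealisation` (`F• → HasMuFreeRealisedZetaFamily` for every cyclotomic `K`, `γ`, pin `I`, `p` odd),
  `exists_perRatio_of_facts`.
* §5 THE GLUE at `p = 7`: `kato2004_classCSeven_memberRealisationPrint_iff` (the Literature fact's unfolded 𝒞₇ hypothesis IS
  `X12.ClassCSeven`, `Iff.rfl`); ★ `muFreeRealisedFamilySeven_of_print (h : F•₇′) (hR3c : <D973 (b) safe class-level form>) :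
  <(E2) letter l.604–610 VERBATIM>`; and the identity `example` feeding v14's consumer
  `GenusSeven.primitiveAdmissibleMemberSeven_of_integralComparison_upToUnit` in its `hE2` slot (g68 §7).

THE OPEN HYPOTHESIS `hR3c` (ruling D973 (b), the SAFE form — «(R3c) holds for SOME print witness in the class», true at Kato's
member `W_K` by g67's `e = 0`; NOT the ∀-data inequality, which is presumptively false off the member): for `W ∈ 𝒞₇`, a
print-realised isogenous member (`MemberRealisationPrint W′ 7`) yields an isogenous member with the FULL letter
(`MemberRealisation W″ 7`, i.e. additionally `0 ≤ v₇(ϖ/(q·q⁻))`).  Its discharge is the successor row R3C-KERNEL (ingredients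
(I1)–(I5) of the seat's P1 line, STATUS l.3860: Kato Thm 12.5 (1) + §13.9, Λ-adic Lemma 13.10 (1), the member lattice, naturality
of `exp*` for the correspondence, the index/period identity).  Typed hypothesis, debt 0; no new fact here.

HONEST LABEL: (E2) is NOT proved — after this file it is CLOSED MODULO {`kato2004_classCSeven_memberRealisationPrint` (print, cited,
p791641), `hR3c` (open, typed)}; crux 19945 stays OPEN (5 sorries); `X12.CMRamifiedSeven` NOT proved; no summit statement is proved;
BSD is claimed for no curve.  No `def`, no instance, no notation, no `sorry`; no Cruxes/Theses import.

[cite: Kato2004Asterisque, (8.1.3) (p. 180), §8.2 and Lemma 8.5 (pp. 180–184), Prop. 8.12 (p. 186), Thm. 9.7 (p. 189), Thm. 12.5 (1) (p. 221), §13.1 and Thm. 13.4 (pp. 224–226), Ex. 13.3 (p. 225), Lemma 13.10 (1) (p. 230), §13.12–13.14 (pp. 231–234)]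
[cite: BlochKato1990, Prop. 3.8 (p. 354)] [cite: Manin1972, Thm. 1.6 and Cor. 3.6] [cite: MazurTateTeitelbaum1986Invent, §I.8]
[cite: NeukirchSchmidtWingberg2008, (1.5.7)] [cite: Washington1997, Ch. 14 (p. 321)] [cite: Wuthrich2014, pp. 391, 394]
-/

set_option autoImplicit false

noncomputable section

open scoped BigOperators NumberField TensorProduct Classical
open Field IsDedekindDomain NumberField CongruenceSubgroup ValuativeRel
open Literature.NumberTheory.GaloisRepresentations
open Literature.NumberTheory.GaloisRepresentations.PeriodRingData
open Literature.NumberTheory.GaloisRepresentations.IsNonarchimedeanLocalField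
open Literature.NumberTheory.PAdicHodge
open Literature.NumberTheory.EllipticCurves Literature.NumberTheory.EllipticCurves.ModularForms
open Literature.NumberTheory.AdelicBaseChange Literature.NumberTheory.Automorphic
open Literature.NumberTheory.EllipticCurves.Kato2004
open Literature.NumberTheory.EllipticCurves.Kato2004.EulerSystemValues Rat.HeightOneSpectrum
open WeierstrassCurve Summit.BirchSwinnertonDyer.Rank1Residual
open Summit.BirchSwinnertonDyer.Rank1Residual.Additive

namespace Summit.BirchSwinnertonDyer.Rank1Residual.Additive.MemberRealisation


/-! ## §1 The Manin minus lattice is cyclic with a positive generator (kernel; was the hypothesis field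
`MultiplierInputs.closure_range_ratMinusSymbol`) -/

section ManinLattice

variable {N : ℕ} [NeZero N] (f : CuspForm (Gamma0 N) 2)

/-- **`ℤ·{[r]⁻_f : r ∈ ℚ} = ℤ·q⁻` with `q⁻ > 0`**, for a weight-2 newform on `Γ₀(N)` with rational coefficients: the minus symbols
have a common denominator `D` (Manin–Drinfeld, tree `exists_forall_ratMinusSymbol_eq_div_of_maninDrinfeld` fed by the tree theorem
`exists_nsmul_modularSymbol_mem_periodLattice_holds`), so their span is a subgroup of the cyclic group `ℤ·(1/D)` — it meets
`(0, 1/D)` trivially, hence is cyclic (`AddSubgroup.cyclic_of_isolated_zero`) — and it is non-zero (`exists_ratMinusSymbol_ne_zero`,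
Manin Thm. 1.6: `V_ℚ(f)⁻ ≠ 0`). [cite: Manin1972, Thm. 1.6 and Cor. 3.6] [cite: MazurTateTeitelbaum1986Invent, §I.8] -/
theorem exists_pos_closure_range_ratMinusSymbol (hf : IsNewform0 f) (hQ : coeffField f = ⊥) :
    ∃ qm : ℚ, 0 < qm ∧ AddSubgroup.closure (Set.range (ratMinusSymbol f)) = AddSubgroup.zmultiples qm := by
  obtain ⟨D, hD, hden⟩ := exists_forall_ratMinusSymbol_eq_div_of_maninDrinfeld
    (exists_nsmul_modularSymbol_mem_periodLattice_holds f)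
  set H := AddSubgroup.closure (Set.range (ratMinusSymbol f)) with hH
  have hD' : (0 : ℚ) < 1 / D := by positivity
  -- `H ≤ ℤ·(1/D)`
  have hle : H ≤ AddSubgroup.zmultiples ((1 : ℚ) / D) := by
    rw [hH, AddSubgroup.closure_le]
    rintro _ ⟨r, rfl⟩
    obtain ⟨m, hm⟩ := hden r
    rw [SetLike.mem_coe, hm, AddSubgroup.mem_zmultiples_iff]
    exact ⟨m, by rw [zsmul_eq_mul]; ring⟩
  -- `H ∩ (0, 1/D) = ∅`
  have hdisj : Disjoint (H : Set ℚ) (Set.Ioo 0 ((1 : ℚ) / D)) := by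
    rw [Set.disjoint_left]
    rintro x hx ⟨h0, h1⟩
    obtain ⟨m, hm⟩ := AddSubgroup.mem_zmultiples_iff.mp (hle hx)
    rw [zsmul_eq_mul] at hm
    rw [← hm] at h0 h1
    have hm0 : (0 : ℚ) < m := by
      by_contra h
      push Not at h
      nlinarith [mul_nonneg (neg_nonneg.mpr h) hD'.le]
    have hm1 : (m : ℚ) < 1 := by
      by_contra h
      push Not at h
      nlinarith [mul_nonneg (sub_nonneg.mpr h) hD'.le]
    have h0' : (0 : ℤ) < m := by exact_mod_cast hm0
    have h1' : m < (1 : ℤ) := by exact_mod_cast hm1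
    omega
  obtain ⟨b, hb⟩ := AddSubgroup.cyclic_of_isolated_zero hD' hdisj
  -- `b ≠ 0`: some minus symbol is non-zero
  obtain ⟨r, hr⟩ := exists_ratMinusSymbol_ne_zero f hf hQ
  have hrH : ratMinusSymbol f r ∈ H := AddSubgroup.subset_closure ⟨r, rfl⟩
  have hb0 : b ≠ 0 := by
    rintro rfl
    rw [hb, AddSubgroup.mem_closure_singleton] at hrH
    obtain ⟨k, hk⟩ := hrH
    exact hr (by rw [← hk, smul_zero])
  refine ⟨|b|, abs_pos.mpr hb0, ?_⟩
  rw [hb, ← AddSubgroup.zmultiples_eq_closure]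
  rcases abs_choice b with h | h <;> rw [h]
  rw [AddSubgroup.zmultiples_neg]

/-- The same for the newform of an elliptic curve `W/ℚ` (rational coefficients by `IsNewformOf.coeffField_eq_bot`).
[cite: Manin1972, Thm. 1.6 and Cor. 3.6] -/
theorem exists_pos_closure_range_ratMinusSymbol_of_isNewformOf {W : WeierstrassCurve ℚ} (hf : IsNewformOf W f) :
    ∃ qm : ℚ, 0 < qm ∧ AddSubgroup.closure (Set.range (ratMinusSymbol f)) = AddSubgroup.zmultiples qm :=
  exists_pos_closure_range_ratMinusSymbol f hf.1 hf.coeffField_eq_bot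

end ManinLattice

/-! ## §2 Galois elements with prescribed cyclotomic character (kernel, from `GaloisRep.cyclotomicCharacter_surjective`) -/

section Cyclotomic

variable (p : ℕ) [Fact p.Prime]

-- (g68's `isUnit_intCast_padicInt` is the tree's `isUnit_intCast_padicInt_of_not_dvd`
-- (`HeegnerEnvelopeReverseCoherentProofs.lean`), reused below by name — `dedup.landed`.)

/-- **`χ_cyc` hits every integer prime to `p`**: there is `σ ∈ Γ_ℚ` with `χ_p(σ) = c` in `ℤ_p` (surjectivity of the cyclotomic
character over `ℚ`, tree `GaloisRep.cyclotomicCharacter_surjective` with `cyclotomic.irreducible_rat`). [cite: Washington1997, Ch. 14 (p. 321)] -/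
theorem exists_cyclotomicCharacter_eq_intCast {c : ℤ} (hc : ¬ (p : ℤ) ∣ c) :
    ∃ σ : absoluteGaloisGroup ℚ, ((GaloisRep.cyclotomicCharacter ℚ p σ : ℤ_[p]ˣ) : ℤ_[p]) = c := by
  obtain ⟨σ, hσ⟩ := GaloisRep.cyclotomicCharacter_surjective ℚ p
    (fun n hn => Polynomial.cyclotomic.irreducible_rat hn) (isUnit_intCast_padicInt_of_not_dvd (p := p) hc).unit
  exact ⟨σ, by rw [hσ, IsUnit.unit_spec]⟩

/-- … and every natural number prime to `p`. [cite: Washington1997, Ch. 14 (p. 321)] -/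
theorem exists_cyclotomicCharacter_eq_natCast {ℓ : ℕ} (hℓ : ¬ p ∣ ℓ) :
    ∃ σ : absoluteGaloisGroup ℚ, ((GaloisRep.cyclotomicCharacter ℚ p σ : ℤ_[p]ˣ) : ℤ_[p]) = ℓ := by
  obtain ⟨σ, hσ⟩ := exists_cyclotomicCharacter_eq_intCast p (c := (ℓ : ℤ)) (by exact_mod_cast hℓ)
  exact ⟨σ, by rw [hσ, Int.cast_natCast]⟩

/-- **One Galois element per tame prime of the gauge**: a function `σ_• : ℕ → Γ_ℚ` with `χ_p(σ_ℓ) = ℓ` for every prime `ℓ ≠ p`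
dividing `A` (the shape of clause (A5′) of the body). [cite: Washington1997, Ch. 14 (p. 321)] -/
theorem exists_cyclotomicCharacter_eq_primeFactors (A : ℕ) :
    ∃ σℓ : ℕ → absoluteGaloisGroup ℚ,
      ∀ ℓ ∈ A.primeFactors.erase p, ((GaloisRep.cyclotomicCharacter ℚ p (σℓ ℓ) : ℤ_[p]ˣ) : ℤ_[p]) = ℓ := by
  classical
  have key : ∀ ℓ : ℕ, ∃ σ : absoluteGaloisGroup ℚ,
      ℓ ∈ A.primeFactors.erase p → ((GaloisRep.cyclotomicCharacter ℚ p σ : ℤ_[p]ˣ) : ℤ_[p]) = ℓ := by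
    intro ℓ
    by_cases h : ℓ ∈ A.primeFactors.erase p
    · have hℓp : ¬ p ∣ ℓ := by
        obtain ⟨hne, hmem⟩ := Finset.mem_erase.mp h
        have hℓ : ℓ.Prime := Nat.prime_of_mem_primeFactors hmem
        intro hd
        exact hne ((Nat.prime_dvd_prime_iff_eq (Fact.out : p.Prime) hℓ).mp hd).symm
      obtain ⟨σ, hσ⟩ := exists_cyclotomicCharacter_eq_natCast p hℓp
      exact ⟨σ, fun _ => hσ⟩
    · exact ⟨1, fun h' => absurd h' h⟩
  choose σℓ hσℓ using key
  exact ⟨σℓ, fun ℓ hℓ => hσℓ ℓ hℓ⟩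

end Cyclotomic

/-! ## §3 The integrality input `hint` of the Λ-adic lift, DISCHARGED (Kato §8.2 functoriality = tree Mackey lemma) -/

section Integral

variable (W : WeierstrassCurve ℚ) [W.IsElliptic] (p : ℕ) [Fact p.Prime]
  [ContinuousSMul ℤ_[p] (W.tateModule p)] {κ : ZpExtension ℚ p} (hκ : κ.IsCyclotomic) (hp : p ≠ 2)

/-- **`Cor : H¹(ℚ(μ_{p^{n+1}}), T_pW) → H¹(ℚ_n, T_pW)` preserves `H¹(ℤ[1/p], ·)`**: the corestriction `levelToLayer` of an integral
class is integral — the tree's general Mackey functoriality `coresLe_mem_integralH1_of_le` (no normality, no unramifiedness of the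
level needed) applied to the definition of `levelToLayer`.  This is the `hint` input of
`IwasawaH1Data.existsUnique_lift_of_isEulerSystem_of_integral` («Kato §8.2; not yet a tree theorem» in that docstring — it now is).
[cite: Kato2004Asterisque, §8.2 and Lemma 8.5 (pp. 180–184), §13.1 (p. 224)] [cite: NeukirchSchmidtWingberg2008, (1.5.7)] -/
theorem levelToLayer_mem_integralH1 (S : Set (HeightOneSpectrum (𝓞 ℚ))) (n : ℕ)
    {x : H1 (tateRep W p) ((cyclotomicLevelsRat p S).level (n + 1) ∅)}
    (hx : x ∈ integralH1 (tateRep W p) p ((cyclotomicLevelsRat p S).level (n + 1) ∅)) :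
    levelToLayer W p hκ hp S n x ∈ integralH1 (tateRep W p) p (κ.layerSubgroup n) := by
  haveI : ((cyclotomicLevelsRat p S).level (n + 1) ∅).FiniteIndex :=
    finiteIndex_of_isOpen_of_compactSpace _ ((cyclotomicLevelsRat p S).isOpen_level (n + 1) ∅)
  letI : Fintype (κ.layerSubgroup n ⧸
      ((cyclotomicLevelsRat p S).level (n + 1) ∅).subgroupOf (κ.layerSubgroup n)) :=
    Fintype.ofFinite _
  exact coresLe_mem_integralH1_of_le (tateRep W p) p _ _ hx

variable [Module.Free ℤ_[p] (W.tateModule p)] [Module.Finite ℤ_[p] (W.tateModule p)]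

/-- **Clause (A4) of the body from `ZetaBody` alone**: an Euler system `z` satisfying `ZetaBody` ((C1) norm relations, (C2)
unramified away from `p` at class level) has a UNIQUE Λ-adic class `y ∈ I.H` in ANY pin `I` of `𝐇¹_Γ(T_pW)` (`Γ = Gal(ℚ_∞/ℚ)`
cyclotomic, `p` odd) with `proj_n y = Cor(z_{n+1,∅})` for all `n` — (C1) feeds `IsEulerSystem`, (C2) feeds integrality via
`levelToLayer_mem_integralH1`.  So the REALISATION DATUM of (E2) does not depend on `K`, `γ` or `I`.
[cite: Kato2004Asterisque, (8.1.3) (p. 180), §8.2 (pp. 180–181), §13.1 and Thm. 13.4 (pp. 224–226)] -/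
theorem existsUnique_lift_of_zetaBody {γ : absoluteGaloisGroup ℚ} (I : IwasawaH1Data W p κ γ)
    {N : ℕ} (f : CuspForm (Gamma0 N) 2) (ι : (m : ℕ) → (CyclotomicField m ℚ →+* ℂ)) (q : ℝ)
    (Λ : ∀ (k : ℕ) (r : Finset (HeightOneSpectrum (𝓞 ℚ))),
      H1 (tateRep W p) (cycSubgroup p k r) →ₗ[ℤ_[p]] ℚ_[p] ⊗[ℚ] CyclotomicField (cycLevel p k r) ℚ)
    (c d₁ a : ℤ) (A : ℕ)
    (z : ∀ (k : ℕ) (r : (cyclotomicLevelsRat p (badPlaces c d₁ A N)).Ideals),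
      H1 (tateRep W p) ((cyclotomicLevelsRat p (badPlaces c d₁ A N)).level k r.1))
    (x : ∀ (k : ℕ) (r : (cyclotomicLevelsRat p (badPlaces c d₁ A N)).Ideals), CyclotomicField (cycLevel p k r.1) ℚ)
    (hzeta : ZetaBody W p f ι q Λ c d₁ a A z x) :
    ∃! y : I.H, ∀ n : ℕ,
      I.proj n y = levelToLayer W p hκ hp (badPlaces c d₁ A N) n
        (z (n + 1) (cyclotomicLevelsRat p (badPlaces c d₁ A N)).idealOne) :=
  IwasawaH1Data.existsUnique_lift_of_isEulerSystem_of_integral W p hκ hp I (badPlaces c d₁ A N) z hzeta.1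
    (fun n => levelToLayer_mem_integralH1 W p hκ hp (badPlaces c d₁ A N) n
      ((mem_integralH1_iff _ _ _ _).mpr (hzeta.2.1 (n + 1) (cyclotomicLevelsRat p (badPlaces c d₁ A N)).idealOne)))

end Integral

/-! ## §4 KERNEL ASSEMBLY: `F• → HasMuFreeRealisedZetaFamilyBody` for every cyclotomic `K`, every `γ`, every pin `I` (`p` odd) -/

section Assembly

variable {W : WeierstrassCurve ℚ} [W.IsElliptic] [W.IsGloballyMinimal] {p : ℕ} [Fact p.Prime]
  [ContinuousSMul ℤ_[p] (W.tateModule p)]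

set_option backward.isDefEq.respectTransparency false in
/-- **THE ASSEMBLY.**  `MemberRealisationBody W p → HasMuFreeRealisedZetaFamilyBody W p K hK I` for `p ≠ 2`, every cyclotomic
`ℤ_p`-extension `K`, every `γ`, every `IwasawaH1Data` pin `I`: instantiate (R2) at g66's diagonal gauge (★ `exists_diagonalGauge`,
fed by (R3)'s `q⁻`), lift the `p`-power levels into `I` (§3, from (C1)+(C2) of `ZetaBody`), pick `σ_c, σ_{d₁}, σ_ℓ` by §2, put
`e := v_p(ϖ/(q·q⁻))`, and take the μ-clause from ★★ `muFree_conjunct_of_diagonalGauge`.  Kernel; no fact consumed.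
[cite: Kato2004Asterisque, §13.9 (p. 229), Lemma 13.10 (1) (p. 230), §13.12–13.14 (pp. 231–234)] -/
theorem hasMuFreeRealisedZetaFamilyBody_of_memberRealisationBody [Module.Free ℤ_[p] (W.tateModule p)]
    [Module.Finite ℤ_[p] (W.tateModule p)] (hp : p ≠ 2) (h : MemberRealisationBody W p)
    (K : ZpExtension ℚ p) (hK : K.IsCyclotomic) {γ : absoluteGaloisGroup ℚ} (I : IwasawaH1Data W p K γ) :
    HasMuFreeRealisedZetaFamilyBody W p K hK I := by
  obtain ⟨N, hN, f, hf, ι, q, Λ, hq, hR1, hfam, qm, perRatio, hqm, hspan, hper0, hper, he⟩ := h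
  -- (A3): the diagonal gauge with its Manin coordinates (g66 ★)
  obtain ⟨c, d₁, a, A, d', n, hA, hc, hd, hdd', hRne, h₁, h₂, h₃, h₄, hpn, hpc, hpd, hc1, hc1', hd1, hd1', -⟩ :=
    MuFreeMultiplier.exists_diagonalGauge (p := p) f hqm hspan
  -- the family in that gauge
  obtain ⟨z, x, hzeta⟩ := hfam c d₁ a A d' hA hc hd hdd' hRne
  -- (A4): the Λ-adic lift into the given pin
  obtain ⟨y, hy, -⟩ := existsUnique_lift_of_zetaBody W p hK hp I f ι _ Λ c d₁ a A z x hzeta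
  -- (A5′): Galois elements
  obtain ⟨σc, hσc⟩ := exists_cyclotomicCharacter_eq_intCast p hpc
  obtain ⟨σd, hσd⟩ := exists_cyclotomicCharacter_eq_intCast p hpd
  obtain ⟨σℓ, hσℓ⟩ := exists_cyclotomicCharacter_eq_primeFactors p A
  exact ⟨hp, N, hN, f, hf, ι, q, Λ, hq, hR1, c, d₁, a, A, d', hA, hc, hd, hdd', hRne, z, x, hzeta, y, hy,
    qm, perRatio, padicValRat p (perRatio / (q * qm)), n, n, n, n, σc, σd, σℓ, hqm, hspan, h₁, h₂, h₃, h₄,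
    hσc, hσd, hσℓ, hper0, hper, rfl,
    MuFreeMultiplier.muFree_conjunct_of_diagonalGauge K hK hpc hpd hc1 hc1' hd1 hd1' hpn hσc hσd hσℓ _ _, he⟩

/-- The CLOSED form: `MemberRealisation W p → HasMuFreeRealisedZetaFamily W p K hK I` (`p ≠ 2`).
[cite: Kato2004Asterisque, §13.12–13.14 (pp. 231–234)] -/
theorem hasMuFreeRealisedZetaFamily_of_memberRealisation (hp : p ≠ 2) (h : MemberRealisation W p)
    (K : ZpExtension ℚ p) (hK : K.IsCyclotomic) {γ : absoluteGaloisGroup ℚ} (I : IwasawaH1Data W p K γ) :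
    HasMuFreeRealisedZetaFamily W p K hK I := by
  letI : Module.Free ℤ_[p] (W.tateModule p) := W.module_free_tateModule_holds p
  letI : Module.Finite ℤ_[p] (W.tateModule p) := W.module_finite_tateModule_holds p
  exact hasMuFreeRealisedZetaFamilyBody_of_memberRealisationBody hp h K hK I

/-- **Remark-lemma (R3's `ϖ` is not content)**: the period-ratio clause of `F•` follows from the two catalogued facts
`nonempty_modularParametrizationData` (BCDT + Néron-lattice datum) and Carayol's `IsNewformOf.level_eq_conductorNorm` — tree
`exists_ne_zero_rat_mul_realPeriodRat_eq_plusPeriod_of_facts`, restated in the body's orientation `plusPeriod f = ϖ * Ω_W`.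
[cite: EdixhovenManin1991, §1] [cite: Carayol1986] -/
theorem exists_perRatio_of_facts (h₁ : nonempty_modularParametrizationData)
    (h₂ : ∀ {N : ℕ} [NeZero N], IsNewformOf.level_eq_conductorNorm (N := N))
    {N : ℕ} [NeZero N] (f : CuspForm (Gamma0 N) 2) (hf : IsNewformOf W f) :
    ∃ perRatio : ℚ, perRatio ≠ 0 ∧ plusPeriod f = ((perRatio : ℚ) : ℝ) * W.realPeriodRat := by
  obtain ⟨ϖ, hϖ, h⟩ := exists_ne_zero_rat_mul_realPeriodRat_eq_plusPeriod_of_facts h₁ h₂ W f hf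
  exact ⟨ϖ, hϖ, h.symm⟩

end Assembly

/-! ## §5 THE GLUE at `p = 7`: `F•₇′` + `hR3c` ⟹ (E2) VERBATIM -/

/-- The Literature fact's 𝒞₇ hypothesis, written in `Rank1Residual/Predicates` vocabulary, IS `X12.ClassCSeven` (definitional
unfolding). [cite: Kato2004Asterisque, Thm. 12.5 (1) (p. 221)] -/
theorem kato2004_classCSeven_memberRealisationPrint_iff :
    Kato2004.kato2004_classCSeven_memberRealisationPrint ↔
      ∀ (W : WeierstrassCurve ℚ) [W.IsElliptic] [W.IsGloballyMinimal] [Fact (Nat.Prime 7)], X12.ClassCSeven W →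
        ∃ (W' : WeierstrassCurve ℚ) (_ : W'.IsElliptic) (_ : W'.IsGloballyMinimal), IsIsogenous W W' ∧
          letI : ContinuousSMul ℤ_[7] (W'.tateModule 7) := TateModule.continuousSMul_padicInt
          Kato2004.MemberRealisationPrint W' 7 :=
  Iff.rfl

/-- ★ **THE (E2) GLUE.**  From the named print fact `F•₇′` (`Kato2004.kato2004_classCSeven_memberRealisationPrint`: every `𝒞₇`
curve has a globally minimal isogenous member realising Kato's value-pinned family with the PRINTED clauses, Thm. 12.5 (1) at the
member lattice) and the OPEN typed hypothesis `hR3c` (ruling D973 (b), safe class-level form: a print-realised member yields a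
member with the full letter incl. `0 ≤ v₇(ϖ/(q·q⁻))` — true at Kato's `W_K` by g67, to be discharged by the R3C-KERNEL row), the
statement of v14's `stub_muFreeRealisedFamilySeven` follows VERBATIM: the witness is `hR3c`'s member, `7 ≠ 2` by `decide`, and
`F• → HasMuFreeRealisedZetaFamily` is §4.  CONDITIONAL on `h` and `hR3c`; (E2) is NOT proved outright.
[cite: Kato2004Asterisque, Thm. 12.5 (1) (p. 221), §13.12–13.14 (pp. 231–234)] [cite: Wuthrich2014, pp. 391, 394] -/
theorem muFreeRealisedFamilySeven_of_print (h : Kato2004.kato2004_classCSeven_memberRealisationPrint)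
    (hR3c : ∀ (W : WeierstrassCurve ℚ) [W.IsElliptic] [W.IsGloballyMinimal] [Fact (Nat.Prime 7)], X12.ClassCSeven W →
      (∃ (W' : WeierstrassCurve ℚ) (_ : W'.IsElliptic) (_ : W'.IsGloballyMinimal), IsIsogenous W W' ∧
        letI : ContinuousSMul ℤ_[7] (W'.tateModule 7) := TateModule.continuousSMul_padicInt
        Kato2004.MemberRealisationPrint W' 7) →
      ∃ (W'' : WeierstrassCurve ℚ) (_ : W''.IsElliptic) (_ : W''.IsGloballyMinimal), IsIsogenous W W'' ∧
        letI : ContinuousSMul ℤ_[7] (W''.tateModule 7) := TateModule.continuousSMul_padicInt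
        Kato2004.MemberRealisation W'' 7) :
    ∀ (W : WeierstrassCurve ℚ) [W.IsElliptic] [W.IsGloballyMinimal] [Fact (Nat.Prime 7)], X12.ClassCSeven W →
      ∃ (W' : WeierstrassCurve ℚ) (_ : W'.IsElliptic) (_ : W'.IsGloballyMinimal), IsIsogenous W W' ∧
        letI : ContinuousSMul ℤ_[7] (W'.tateModule 7) := TateModule.continuousSMul_padicInt
        ∀ (K : ZpExtension ℚ 7) (hK : K.IsCyclotomic) (γ : Field.absoluteGaloisGroup ℚ) (_ : K.IsTopGenerator γ)
          (I : IwasawaH1Data W' 7 K γ), Kato2004.HasMuFreeRealisedZetaFamily W' 7 K hK I := by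
  intro W _ _ _ hC
  obtain ⟨W', hE', hM', hiso, hF⟩ := hR3c W hC (h W hC)
  refine ⟨W', hE', hM', hiso, ?_⟩
  letI : ContinuousSMul ℤ_[7] (W'.tateModule 7) := TateModule.continuousSMul_padicInt
  intro K hK γ _ I
  exact hasMuFreeRealisedZetaFamily_of_memberRealisation (by decide) hF K hK I

/-! ## §6 IDENTITY CHECK against v14's consumer: the glue's conclusion IS the `hE2` binder of
`GenusSeven.primitiveAdmissibleMemberSeven_of_integralComparison_upToUnit` (g68 §7, kernel) -/

/-- v14's 2★-composition with the (E2) slot filled by the glue (all other slots kept as binders).  CONDITIONAL on `h`, `hR3c` and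
v14's remaining inputs; nothing closes. [cite: Kato2004Asterisque, Thm. 12.5 (1)(4) (pp. 221–222)] -/
example (h : Kato2004.kato2004_classCSeven_memberRealisationPrint)
    (hR3c : ∀ (W : WeierstrassCurve ℚ) [W.IsElliptic] [W.IsGloballyMinimal] [Fact (Nat.Prime 7)], X12.ClassCSeven W →
      (∃ (W' : WeierstrassCurve ℚ) (_ : W'.IsElliptic) (_ : W'.IsGloballyMinimal), IsIsogenous W W' ∧
        letI : ContinuousSMul ℤ_[7] (W'.tateModule 7) := TateModule.continuousSMul_padicInt
        Kato2004.MemberRealisationPrint W' 7) →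
      ∃ (W'' : WeierstrassCurve ℚ) (_ : W''.IsElliptic) (_ : W''.IsGloballyMinimal), IsIsogenous W W'' ∧
        letI : ContinuousSMul ℤ_[7] (W''.tateModule 7) := TateModule.continuousSMul_padicInt
        Kato2004.MemberRealisation W'' 7) :=
  fun a₁ a₂ a₃ a₄ a₅ a₆ a₇ =>
    GenusSeven.primitiveAdmissibleMemberSeven_of_integralComparison_upToUnit a₁ a₂ a₃ a₄ a₅ a₆ a₇
      (muFreeRealisedFamilySeven_of_print h hR3c)

end Summit.BirchSwinnertonDyer.Rank1Residual.Additive.MemberRealisation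

end
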